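import Summits.ResolutionOfSingularities.ResolutionOfSingularities.Theorems.EquisingularLiftEquisingularLiftNatSpecialFibreMaxPoints
import Summits.ResolutionOfSingularities.ResolutionOfSingularities.Theorems.EquisingularLiftCampaignW45bULTSpecialFibrePersists
import Literature.AlgebraicGeometry.Resolution.BlowupsIntegral
import HarnessLib

/-!
# [OURS · L1 W4.5(b) · EL♮] Lemma V, creation half: a regular centre with a VERTICAL piece makes the next special fibre
# REDUCIBLE (Krull's principal ideal theorem at a maximal point of the exceptional Cartier divisor)
# (crux `EquisingularLiftNat` = stmt-ResolutionOfSingularities-20038; V-pack step 3)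

HONEST FRAMING. OURS (cell res-hironaka, crux chain w45b, slot W4.5(b)); NOT a statement of any manuscript; AI-written,
weaker than expert review. Helper `--supports stmt-ResolutionOfSingularities-20038 --as helper`. Plan of record:
L/w45b/CRUX-PLAN.md v3.0.1 §1.6, L/w45b/EL-NATURAL/ULT-L0COMP-WORDS.md §V; companion of `…NatSpecialFibreMaxPoints.lean`
(p503337), `…NatFirstTouchIrreducible.lean`, res-type-100's `…CampaignW45bULTSpecialFibrePersists.lean` (persistence half,
`surjective_of_isBlowup`).

* `eq_genericPoint_of_specializes_maxPt_of_isEffectiveCartier` — KRULL: on an integral locally Noetherian scheme, a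
  point `w` maximal for specialisation in the support of an effective Cartier divisor `E` has `dim 𝒪_{X,w} ≤ 1`, so the
  only proper generisation of `w` is the generic point of `X` (affine chart; `Ideal.height_le_one_of_isPrincipal_of_mem_
  minimalPrimes`; `Ideal.height_eq_zero_iff_eq_bot`).
* `not_isIrreducible_preimage_of_vertical` — for a blow-up `τ : X″ → X′` of an integral locally Noetherian `X′` along
  `C ≠ ⊥`, a closed irreducible `F′ ⊆ X′` (the special fibre) not containing the generic point of `X′`, whose generic
  point is off `supp C`, and a point `x₀ ∈ supp C` all of whose generisations inside `supp C` lie in `F′` (a VERTICAL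
  piece of the centre at `x₀`): `τ⁻¹F′` is NOT irreducible. [The maximal point `m ⤳ x₀` of `supp C` lies in `F′`; over it
  sits a maximal point `w` of the exceptional divisor `E = τ⁻¹(supp C)` (blow-ups are onto); if `τ⁻¹F′` were irreducible
  its generic point `ξ` would be a proper generisation of `w`, hence the generic point of `X″` by KRULL, hence off
  `τ⁻¹F′`.]
* `exists_horizontal_generization_of_isIrreducible` — contrapositive packaging: if `F′` and `τ⁻¹F′` are both irreducible,
  every `x₀ ∈ supp C` has a generisation `c ∈ supp C` OFF `F′` (the horizontality clause of `ULTAt`).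

References: Krull's Hauptidealsatz (Mathlib `Ideal.height_le_one_of_isPrincipal_of_mem_minimalPrimes`); Görtz–Wedhorn I
Prop. 13.91, Def. 13.90 [GortzWedhorn2020]; Stacks 02ND/02NS/02OS; tree `IsBlowup.isIntegral`, `IsBlowup.isProper`,
`EquisingularLift.surjective_of_isBlowup`, `exists_maxPt_specializes`.
-/

set_option linter.dupNamespace false -- mandated namespace `Summit.<Summit>.<Problem>` of this single-conjunct summit

open CategoryTheory AlgebraicGeometry TopologicalSpace Topology
open Literature.AlgebraicGeometry.Resolution
open AlgebraicGeometry.Scheme.IdealSheafData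
open Summit.ResolutionOfSingularities.ResolutionOfSingularities.Theorems.EquisingularLift

namespace Summit.ResolutionOfSingularities.ResolutionOfSingularities.Cruxes.EquisingularLiftNat.Sections

universe u

/-! ## Krull at a maximal point of an effective Cartier divisor -/

/-- **KRULL at a maximal point of an effective Cartier divisor.** Let `X` be an integral locally Noetherian scheme, `E`
an ideal sheaf which is an effective Cartier divisor, and `w ∈ supp E` maximal for specialisation inside `supp E`.
Then every generisation `y ≠ w` of `w` is the generic point of `X` (`dim 𝒪_{X,w} ≤ 1` by the principal ideal theorem
in an affine chart where `E = V(t)`). [folklore; Krull] -/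
theorem eq_genericPoint_of_specializes_maxPt_of_isEffectiveCartier {X : Scheme.{u}} [IsIntegral X]
    [IsLocallyNoetherian X] {E : X.IdealSheafData} (hE : IsEffectiveCartier E) {w : X}
    (hw : w ∈ (E.support : Set X) ∧ ∀ y ∈ (E.support : Set X), y ⤳ w → y = w)
    {y : X} (hyw : y ⤳ w) (hne : y ≠ w) : y = genericPoint X := by
  obtain ⟨U, hwU, t, -, hEU⟩ := hE w
  have hU : IsAffineOpen (U : X.Opens) := U.2
  haveI : Nonempty ↥(U : X.Opens) := ⟨⟨w, hwU⟩⟩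
  haveI : IsNoetherianRing Γ(X, U) := IsLocallyNoetherian.component_noetherian U
  haveI : IsDomain Γ(X, U) := @IsIntegral.component_integral _ _ (U : X.Opens) ⟨⟨w, hwU⟩⟩
  have hyU : y ∈ (U : X.Opens) := hyw.mem_open U.1.isOpen hwU
  -- membership in `supp E` of a point of the chart, read on the prime
  have key : ∀ z : PrimeSpectrum Γ(X, U), hU.fromSpec z ∈ (E.support : Set X) ↔ t ∈ z.asIdeal := by
    intro z
    have hzU : hU.fromSpec z ∈ (U : X.Opens) := by
      have : hU.fromSpec z ∈ Set.range hU.fromSpec := ⟨z, rfl⟩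
      rwa [hU.range_fromSpec] at this
    rw [SetLike.mem_coe, Scheme.IdealSheafData.mem_support_iff_of_mem (U := U) hzU, hEU, Scheme.zeroLocus_span,
      Scheme.mem_zeroLocus_iff]
    simp only [Set.mem_singleton_iff, forall_eq]
    rw [show (hU.fromSpec z ∈ X.basicOpen t) ↔ z ∈ hU.fromSpec ⁻¹ᵁ X.basicOpen t from Iff.rfl,
      hU.fromSpec_preimage_basicOpen]
    exact not_not
  -- the primes of `w` and `y`
  set 𝔭 := hU.primeIdealOf ⟨w, hwU⟩ with h𝔭def
  set 𝔮 := hU.primeIdealOf ⟨y, hyU⟩ with h𝔮def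
  have h𝔭 : hU.fromSpec 𝔭 = w := hU.fromSpec_primeIdealOf ⟨w, hwU⟩
  have h𝔮 : hU.fromSpec 𝔮 = y := hU.fromSpec_primeIdealOf ⟨y, hyU⟩
  have ht𝔭 : t ∈ 𝔭.asIdeal := (key 𝔭).mp (by rw [h𝔭]; exact hw.1)
  -- `𝔭` is minimal over `(t)`
  have hmin : 𝔭.asIdeal ∈ (Ideal.span {t}).minimalPrimes := by
    refine ⟨⟨𝔭.2, (Ideal.span_singleton_le_iff_mem _).mpr ht𝔭⟩, ?_⟩
    rintro q ⟨hq, htq⟩ hq𝔭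
    let z : PrimeSpectrum Γ(X, U) := ⟨q, hq⟩
    have hzE : hU.fromSpec z ∈ (E.support : Set X) := (key z).mpr ((Ideal.span_singleton_le_iff_mem _).mp htq)
    have hzw : hU.fromSpec z ⤳ w := by
      rw [← h𝔭]
      exact ((PrimeSpectrum.le_iff_specializes _ _).mp hq𝔭).map hU.fromSpec.continuous
    have hzw' : hU.fromSpec z = hU.fromSpec 𝔭 := (hw.2 _ hzE hzw).trans h𝔭.symm
    have hz𝔭 : z = 𝔭 := hU.fromSpec.isOpenEmbedding.injective hzw'
    show 𝔭.asIdeal ≤ q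
    rw [← hz𝔭]
  have hht : 𝔭.asIdeal.height ≤ 1 := Ideal.height_le_one_of_isPrincipal_of_mem_minimalPrimes _ _ hmin
  -- `𝔮 < 𝔭`
  have hle : 𝔮 ≤ 𝔭 := by
    rw [PrimeSpectrum.le_iff_specializes]
    have : hU.fromSpec 𝔮 ⤳ hU.fromSpec 𝔭 := by rw [h𝔮, h𝔭]; exact hyw
    exact hU.fromSpec.isOpenEmbedding.isInducing.specializes_iff.mp this
  have hne' : 𝔮 ≠ 𝔭 := fun h => hne (by rw [← h𝔮, ← h𝔭, h])
  have hlt : 𝔮.asIdeal < 𝔭.asIdeal := lt_of_le_of_ne hle (fun h => hne' (PrimeSpectrum.ext h))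
  have h𝔮0 : 𝔮.asIdeal = ⊥ := by
    have h1 : 𝔮.asIdeal.height < 𝔭.asIdeal.height := Ideal.height_strict_mono_of_isPrime_of_isPrime hlt
    have h2 : 𝔮.asIdeal.height < 1 := lt_of_lt_of_le h1 hht
    have h3 : 𝔮.asIdeal.height = 0 := by
      simpa using h2
    exact Ideal.height_eq_zero_iff_eq_bot.mp h3
  -- hence `y` is the generic point
  have h𝔮gen : 𝔮 = genericPoint (Spec Γ(X, U)) := by
    rw [genericPoint_eq_bot_of_affine]
    exact PrimeSpectrum.ext h𝔮0
  rw [← h𝔮, h𝔮gen]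
  exact genericPoint_eq_of_isOpenImmersion hU.fromSpec


/-! ## A vertical piece of the centre makes the next special fibre reducible -/

/-- **LEMMA V (creation half).** Let `τ : X″ → X′` be a blow-up of an integral locally Noetherian scheme along `C ≠ ⊥`,
`F′ ⊆ X′` closed and irreducible with generic point `ζ ∉ supp C` and not containing the generic point of `X′`, and
`x₀ ∈ supp C` a point all of whose generisations inside `supp C` lie in `F′` (the centre is VERTICAL at `x₀`). Then
`τ⁻¹F′` is not irreducible. [folklore; Krull + GW I Prop. 13.91] -/
theorem not_isIrreducible_preimage_of_vertical {X' X'' : Scheme.{u}} [IsIntegral X'] [IsLocallyNoetherian X']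
    (τ : X'' ⟶ X') (C : X'.IdealSheafData) (hτ : IsBlowup τ C) (hC : C ≠ ⊥)
    (F' : Set X') (hF' : IsClosed F') (hgen : genericPoint X' ∉ F')
    {ζ : X'} (hζ : IsGenericPoint ζ F') (hζC : ζ ∉ (C.support : Set X'))
    {x₀ : X'} (hx₀ : x₀ ∈ (C.support : Set X'))
    (hvert : ∀ c ∈ (C.support : Set X'), c ⤳ x₀ → c ∈ F') :
    ¬ IsIrreducible (τ ⁻¹' F') := by
  intro hirr
  haveI : IsIntegral X'' := hτ.isIntegral hC
  haveI : IsProper τ := hτ.isProper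
  haveI : IsLocallyNoetherian X'' := LocallyOfFiniteType.isLocallyNoetherian τ
  have hsurj : Function.Surjective τ := surjective_of_isBlowup hτ hC
  -- a maximal point `m` of `supp C` above `x₀`; it lies in `F'`
  obtain ⟨m, hm, hmx₀⟩ := exists_maxPt_specializes C.support.isClosed hx₀
  have hmF : m ∈ F' := hvert m hm.1 hmx₀
  -- a maximal point `w` of the exceptional divisor `E = supp (C.comap τ)` over `m`
  have hEsupp : ((C.comap τ).support : Set X'') = τ ⁻¹' (C.support : Set X') := by
    rw [Scheme.IdealSheafData.support_comap]; rfl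
  obtain ⟨e, he⟩ := hsurj m
  have heE : e ∈ ((C.comap τ).support : Set X'') := by
    rw [hEsupp]; show τ e ∈ (C.support : Set X'); rw [he]; exact hm.1
  obtain ⟨w, hw, hwe⟩ := exists_maxPt_specializes (C.comap τ).support.isClosed heE
  have hτwC : τ w ∈ (C.support : Set X') := by
    have := hw.1; rw [hEsupp] at this; exact this
  have hτw : τ w = m := by
    have h1 : τ w ⤳ τ e := hwe.map τ.base.hom.continuous
    rw [he] at h1
    exact hm.2 _ hτwC h1
  have hwF : w ∈ τ ⁻¹' F' := show τ w ∈ F' by rw [hτw]; exact hmF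
  -- the generic point `ξ` of `τ⁻¹F'` is a proper generisation of `w`
  obtain ⟨ξ, hξ⟩ := QuasiSober.sober hirr (hF'.preimage τ.base.hom.continuous)
  have hξw : ξ ⤳ w := hξ.specializes hwF
  have hτξ : IsGenericPoint (τ ξ) F' := by
    have h1 := hξ.image τ.base.hom.continuous
    rwa [Set.image_preimage_eq F' hsurj, hF'.closure_eq] at h1
  have hξne : ξ ≠ w := by
    intro h
    apply hζC
    rw [← hτξ.eq hζ, h]
    exact hτwC
  -- by KRULL it is the generic point of `X''`, which is not in `τ⁻¹F'`
  have hξgen : ξ = genericPoint X'' :=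
    eq_genericPoint_of_specializes_maxPt_of_isEffectiveCartier hτ.isEffectiveCartier hw hξw hξne
  have hτgen : τ (genericPoint X'') = genericPoint X' := by
    have h1 := (genericPoint_spec X'').image τ.base.hom.continuous
    rw [Set.image_univ, hsurj.range_eq, closure_univ] at h1
    exact h1.eq (genericPoint_spec X')
  apply hgen
  have : τ ξ ∈ F' := hξ.mem
  rwa [hξgen, hτgen] at this

/-- **Horizontality from two irreducible special fibres.** In the setting of `not_isIrreducible_preimage_of_vertical`,
if `τ⁻¹F′` IS irreducible then every point `x₀ ∈ supp C` has a generisation `c ∈ supp C` off `F′` — the horizontality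
clause of `ULTAt`. [folklore] -/
theorem exists_horizontal_generization_of_isIrreducible {X' X'' : Scheme.{u}} [IsIntegral X'] [IsLocallyNoetherian X']
    (τ : X'' ⟶ X') (C : X'.IdealSheafData) (hτ : IsBlowup τ C) (hC : C ≠ ⊥)
    (F' : Set X') (hF' : IsClosed F') (hgen : genericPoint X' ∉ F')
    {ζ : X'} (hζ : IsGenericPoint ζ F') (hζC : ζ ∉ (C.support : Set X'))
    (hirr : IsIrreducible (τ ⁻¹' F')) {x₀ : X'} (hx₀ : x₀ ∈ (C.support : Set X')) :
    ∃ c : X', c ∈ (C.support : Set X') ∧ c ∉ F' ∧ c ⤳ x₀ := by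
  by_contra h
  push Not at h
  exact not_isIrreducible_preimage_of_vertical τ C hτ hC F' hF' hgen hζ hζC hx₀
    (fun c hc hcx => by by_contra hcF; exact h c hc hcF hcx) hirr

end Summit.ResolutionOfSingularities.ResolutionOfSingularities.Cruxes.EquisingularLiftNat.Sections
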